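import Summits.Ventures.PercRepro.GenQTraceHypAddTwo

/-!
# PercRepro — «trace + ANY finite set of points»: the balance and the trace sum of `τ ∪ X` dominate an explicit
functional of `τ` (night-4, gen 10)

For disjoint finite `τ, X ⊆ E` every rank-`(q + 1)` subset `S` of `G = τ ∪ X` is `B ∪ Y` with `B = S ∩ τ`,
`Y = S ∩ X` and `ρ(B ∪ Y) = q + 1` (`Rq_union_eq_image_sigma`: a bijection with the pairs `(Y, B)`, `Y ⊆ X`,
`B ⊆ τ`, `ρ(B ∪ Y) = q + 1`).  Its coloop count is at most `m(B) + |Y|` (`mTr_union_le`), so the balance of `G` at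
level `q + 1` and type `t` dominates
`hypAddProfile M τ X q t = Σ_{Y ⊆ X} Σ_{B ⊆ τ, ρ(B ∪ Y) = q + 1} ((q + 3 − t)/(1 + m(B) + |Y|) − Φ·dem M G t (B ∪ Y))`
(`Jq_hyp_add_ge_profile`), and the level-`(q + 2)` trace sum of `G` (a rank-`(q + 1)` set) dominates the same sum
with the trace weights `1/(2 + m(B) + |Y|)` (`traceSum_hyp_add_ge_profile`, `traceHypAddProfile`).  These are the
«hyperplane + 3 points» shape of the type layer and the «rank-`q` trace + `j` points» shapes of the trace layer
(every `j`) as profile inequalities of the trace `τ` — the crude-weight cousins of `hypAddTwoProfile` /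
`traceHypAddTwoProfile` (which keep the exact coloop counts of the two-point case).  Nothing here is claimed
non-negative: the functionals are the statements the near end of the diagonal needs.
-/
namespace PercRepro.GenQ

open Finset ThmH SixFour

variable {α : Type*} [DecidableEq α] {M : Matroid α} [M.Finite]

section HypAddGen

variable {τ X : Finset α} {q t : ℕ}

/-- Coloops of `B ∪ Y` are at most `m(B) + |Y|` (each new point adds at most one, `mTr_insert_le`). -/
theorem mTr_union_le (B Y : Finset α) : mTr M (B ∪ Y) ≤ mTr M B + Y.card := by
  induction Y using Finset.induction_on with
  | empty => simp
  | insert a Y ha ih =>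
    rw [Finset.union_insert, Finset.card_insert_of_notMem ha]
    calc mTr M (insert a (B ∪ Y)) ≤ mTr M (B ∪ Y) + 1 := mTr_insert_le (M := M) _ a
      _ ≤ mTr M B + Y.card + 1 := by omega

/-- The subsets `B ⊆ τ` that `Y` lifts to rank `r`: `ρ(B ∪ Y) = r`. -/
noncomputable def liftSets (M : Matroid α) [M.Finite] (τ Y : Finset α) (r : ℕ) : Finset (Finset α) :=
  τ.powerset.filter (fun B => M.eRk ((B ∪ Y : Finset α) : Set α) = (r : ℕ∞))

/-- Membership in `liftSets`: `B ⊆ τ` and `ρ(B ∪ Y) = r`. -/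
theorem mem_liftSets {B Y : Finset α} {r : ℕ} :
    B ∈ liftSets M τ Y r ↔ B ⊆ τ ∧ M.eRk ((B ∪ Y : Finset α) : Set α) = (r : ℕ∞) := by
  unfold liftSets
  rw [Finset.mem_filter, Finset.mem_powerset]

/-- **The decomposition of `R_r(τ ∪ X)`**: the image of the pairs `(Y, B)`, `Y ⊆ X`, `B ∈ liftSets τ Y r`, under
`(Y, B) ↦ B ∪ Y` (no disjointness needed for the covering; it is needed for the injectivity below). -/
theorem Rq_union_eq_image_sigma (τ X : Finset α) (r : ℕ) :
    Rq M (τ ∪ X) r =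
      (X.powerset.sigma (fun Y => liftSets M τ Y r)).image (fun p : Σ _ : Finset α, Finset α => p.2 ∪ p.1) := by
  ext S
  rw [Finset.mem_image, mem_Rq]
  constructor
  · rintro ⟨hS, hr⟩
    refine ⟨⟨S ∩ X, S ∩ τ⟩, ?_, ?_⟩
    · rw [Finset.mem_sigma, Finset.mem_powerset, mem_liftSets]
      refine ⟨Finset.inter_subset_right, Finset.inter_subset_right, ?_⟩
      have : S ∩ τ ∪ S ∩ X = S := by
        rw [← Finset.inter_union_distrib_left]
        exact Finset.inter_eq_left.2 hS
      rw [this, hr]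
    · show S ∩ τ ∪ S ∩ X = S
      rw [← Finset.inter_union_distrib_left]
      exact Finset.inter_eq_left.2 hS
  · rintro ⟨⟨Y, B⟩, hp, rfl⟩
    rw [Finset.mem_sigma, Finset.mem_powerset, mem_liftSets] at hp
    exact ⟨Finset.union_subset_union hp.2.1 hp.1, hp.2.2⟩

/-- `(Y, B) ↦ B ∪ Y` is injective on the pairs with `Y ⊆ X`, `B ⊆ τ` (`τ`, `X` disjoint). -/
theorem union_inj_on_sigma (hdisj : Disjoint τ X) (r : ℕ) :
    Set.InjOn (fun p : Σ _ : Finset α, Finset α => p.2 ∪ p.1)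
      ((X.powerset.sigma (fun Y => liftSets M τ Y r)) : Set (Σ _ : Finset α, Finset α)) := by
  rintro ⟨Y, B⟩ hp ⟨Y', B'⟩ hp' h
  simp only [Finset.coe_sigma, Set.mem_sigma_iff, Finset.mem_coe, Finset.mem_powerset, mem_liftSets] at hp hp'
  simp only at h
  have hB : B = B' := by
    ext x
    constructor
    · intro hx
      have : x ∈ B' ∪ Y' := h ▸ Finset.mem_union_left _ hx
      rcases Finset.mem_union.1 this with hx' | hx'
      · exact hx'
      · exact absurd (Finset.disjoint_left.1 hdisj (hp.2.1 hx) (hp'.1 hx')) (by simp)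
    · intro hx
      have : x ∈ B ∪ Y := h ▸ Finset.mem_union_left _ hx
      rcases Finset.mem_union.1 this with hx' | hx'
      · exact hx'
      · exact absurd (Finset.disjoint_left.1 hdisj (hp'.2.1 hx) (hp.1 hx')) (by simp)
  have hY : Y = Y' := by
    ext x
    constructor
    · intro hx
      have : x ∈ B' ∪ Y' := h ▸ Finset.mem_union_right _ hx
      rcases Finset.mem_union.1 this with hx' | hx'
      · exact absurd (Finset.disjoint_left.1 hdisj (hp'.2.1 hx') (hp.1 hx)) (by simp)
      · exact hx'
    · intro hx
      have : x ∈ B ∪ Y := h ▸ Finset.mem_union_right _ hx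
      rcases Finset.mem_union.1 this with hx' | hx'
      · exact absurd (Finset.disjoint_left.1 hdisj (hp.2.1 hx') (hp'.1 hx)) (by simp)
      · exact hx'
  subst hB; subst hY; rfl

/-- **The profile functional of the trace `τ` with the point set `X`** at level `q + 1`, type `t`: over the pairs
`(Y, B)` with `Y ⊆ X`, `B ⊆ τ`, `ρ(B ∪ Y) = q + 1`, the weight `(q + 3 − t)/(1 + m(B) + |Y|)` against the demand of
`B ∪ Y` in `τ ∪ X`. -/
noncomputable def hypAddProfile (M : Matroid α) [M.Finite] (τ X : Finset α) (q t : ℕ) : ℚ :=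
  ∑ Y ∈ X.powerset, ∑ B ∈ liftSets M τ Y (q + 1),
    ((((q + 1 : ℕ) : ℚ) + 2 - t) * (1 / (1 + (mTr M B : ℚ) + Y.card)) -
      ((((q + 1 : ℕ) : ℚ) + 2) / (((q + 1 : ℕ) : ℚ) + 1)) * dem M (τ ∪ X) t (B ∪ Y))

/-- **The balance of `τ ∪ X` at level `q + 1` dominates the profile functional of `τ`** (every type `t ≤ q + 1`,
disjoint `τ`, `X`). -/
theorem Jq_hyp_add_ge_profile (hdisj : Disjoint τ X) (ht : t ≤ q + 1) :
    hypAddProfile M τ X q t ≤ Jq M (τ ∪ X) (q + 1) t := by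
  rw [Jq_succ_eq_sum_hfun, Rq_union_eq_image_sigma τ X, Finset.sum_image (union_inj_on_sigma hdisj _),
    Finset.sum_sigma]
  unfold hypAddProfile
  apply Finset.sum_le_sum
  intro Y _
  apply Finset.sum_le_sum
  intro B _
  unfold hfun
  apply sub_le_sub_right
  apply mul_le_mul_of_nonneg_left _ (coeff_nonneg ht)
  unfold wInf
  apply one_div_le_one_div_of_le (by positivity)
  have := mTr_union_le (M := M) B Y
  have h' : (mTr M (B ∪ Y) : ℚ) ≤ mTr M B + Y.card := by exact_mod_cast this
  linarith

/-- **The trace-layer profile functional of `τ` with the point set `X`**: the level-`(q + 2)` trace sum's weights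
`(q + 4 − t)/(2 + m(B) + |Y|)` against the demand of `B ∪ Y` in `τ ∪ X`, over the same pairs. -/
noncomputable def traceHypAddProfile (M : Matroid α) [M.Finite] (τ X : Finset α) (q t : ℕ) : ℚ :=
  ∑ Y ∈ X.powerset, ∑ B ∈ liftSets M τ Y (q + 1),
    ((((q + 1 + 1 : ℕ) : ℚ) + 2 - t) * (1 / (2 + (mTr M B : ℚ) + Y.card)) -
      ((((q + 1 + 1 : ℕ) : ℚ) + 2) / (((q + 1 + 1 : ℕ) : ℚ) + 1)) * dem M (τ ∪ X) t (B ∪ Y))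

/-- **The level-`(q + 2)` trace sum of `τ ∪ X` dominates the trace-layer profile functional of `τ`** (every type
`t ≤ q + 2`, disjoint `τ`, `X`). -/
theorem traceSum_hyp_add_ge_profile (hdisj : Disjoint τ X) (ht : t ≤ q + 2) :
    traceHypAddProfile M τ X q t ≤
      ∑ B ∈ Rq M (τ ∪ X) (q + 1),
        ((((q + 1 + 1 : ℕ) : ℚ) + 2 - t) * (1 / (2 + (mTr M B : ℚ))) -
          ((((q + 1 + 1 : ℕ) : ℚ) + 2) / (((q + 1 + 1 : ℕ) : ℚ) + 1)) * dem M (τ ∪ X) t B) := by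
  rw [Rq_union_eq_image_sigma τ X, Finset.sum_image (union_inj_on_sigma hdisj _), Finset.sum_sigma]
  unfold traceHypAddProfile
  apply Finset.sum_le_sum
  intro Y _
  apply Finset.sum_le_sum
  intro B _
  apply sub_le_sub_right
  apply mul_le_mul_of_nonneg_left _ (tcoeff_nonneg ht)
  apply one_div_le_one_div_of_le (by positivity)
  have := mTr_union_le (M := M) B Y
  have h' : (mTr M (B ∪ Y) : ℚ) ≤ mTr M B + Y.card := by exact_mod_cast this
  linarith

end HypAddGen

end PercRepro.GenQ
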